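import Literature.NumberTheory.Transcendental.Analytification
import Mathlib.AlgebraicGeometry.ZariskisMainTheorem
import Mathlib.AlgebraicGeometry.Morphisms.FormallyUnramified
import HarnessLib

/-!
# An unramified morphism of `ℂ`-schemes injective on complex points is a monomorphism; if proper, a closed immersion
# (EGA IV₄ 17.2.6; Stacks Project Tag 04XV; Deligne, *Travaux de Shimura*, proof of Prop. 1.15)

Topic `Literature/AlgebraicGeometry/Morphisms`, namespace `Literature.AlgebraicGeometry.Morphisms`.  THEOREMS ONLY
(no definition, no named fact, no `sorry`).  Cell `hodgecm-mathlib`, fan B-III (T3) = binder I-1′ (item 24835), B-plan2's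
v4 child `stub_S2imm` («the embedding `X_K ⊗ ℂ ⟶ Sh_{K‡}(GSp, S^±)_ℂ` is a closed immersion»), LAYER 1 = the generic last
step of [Deligne 1971] Prop. 1.15: «`u` est finie et non ramifiée; il suffit de montrer que `u` est injectif».  Banked leaf;
no floor change.

For `ℂ`-schemes `X`, `Y` locally of finite type and a `ℂ`-morphism `f : X ⟶ Y`:

* `mono_left_of_formallyUnramified_of_injective_complexPoints` — if `f` is unramified and INJECTIVE ON COMPLEX POINTS
  (`X(ℂ) → Y(ℂ)`), then `f` is a monomorphism of schemes.  Proof: the diagonal `Δ : X ⟶ X ×_Y X` of an unramified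
  morphism is an open immersion (Mathlib `isOpenImmersion_diagonal`); a closed point of the locally-of-finite-type
  `ℂ`-scheme `X ×_Y X` is a complex point (Nullstellensatz, ★ `ComplexPoints.equivClosedPoints`), i.e. a pair of complex
  points of `X` with the same image, hence on the diagonal by injectivity; so the open image of `Δ` contains every closed
  point of a Jacobson space and `Δ` is surjective, hence an isomorphism, hence `f` is a monomorphism
  (`pullback.isIso_diagonal_iff`).
* `isClosedImmersion_left_of_isProper_of_formallyUnramified_of_injective_complexPoints` — if moreover `f` is proper,
  `f` is a closed immersion (proper monomorphism, Mathlib `IsClosedImmersion.iff_isProper_and_mono`, [Stacks 04XV]).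

## References
* A. Grothendieck, EGA IV₄ (Publ. Math. IHÉS 32, 1967), Prop. 17.2.6 (monomorphisme ⟺ radiciel et non ramifié),
  Cor. 18.12.6 (propre + monomorphisme ⟹ immersion fermée). [Grothendieck1967]
* The Stacks Project, Tag 04XV (closed immersion ⟺ proper monomorphism ⟺ proper, unramified, universally injective).
  [StacksProject]
* P. Deligne, *Travaux de Shimura*, Sém. Bourbaki 389 (1971), Prop. 1.15 and Lemme 1.15.3 (p. 132).
  [Deligne1971TravauxShimura]
-/

set_option autoImplicit false

noncomputable section

open CategoryTheory CategoryTheory.Limits AlgebraicGeometry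

namespace Literature.AlgebraicGeometry.Morphisms

open Literature.AlgebraicGeometry.Motives

variable {X Y : SchemeOver ℂ} (f : X ⟶ Y)

/-- **An unramified `ℂ`-morphism injective on complex points is a monomorphism** (EGA IV₄ 17.2.6 / Stacks 04XV over `ℂ`,
with «universally injective» read off the complex points by the Nullstellensatz): for `X`, `Y` locally of finite type over
`ℂ`, `f : X ⟶ Y` unramified with `X(ℂ) → Y(ℂ)` injective, `f` is a monomorphism of schemes.  The diagonal of `f` is an open
immersion whose image contains every closed point of `X ×_Y X` (closed points are complex points, and a complex point of
`X ×_Y X` is a pair of complex points of `X` with equal images), hence is surjective on the Jacobson space `X ×_Y X`, hence an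
isomorphism.  This is the generic last step of [Deligne 1971] Prop. 1.15 («il suffit de montrer que `u` est injectif»).
[cite: Grothendieck1967, Prop. 17.2.6] [cite: StacksProject, Tag 04XV] [cite: Deligne1971TravauxShimura, Prop. 1.15 with Lemme 1.15.3 (p. 132)] -/
theorem mono_left_of_formallyUnramified_of_injective_complexPoints [LocallyOfFiniteType X.hom]
    [LocallyOfFiniteType Y.hom] [FormallyUnramified f.left]
    (hinj : Function.Injective (AlgPoints.map f : ComplexPoints X → ComplexPoints Y)) : Mono f.left := by
  haveI : LocallyOfFiniteType f.left := by
    have : LocallyOfFiniteType (f.left ≫ Y.hom) := by rw [Over.w f]; infer_instance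
    exact locallyOfFiniteType_of_comp f.left Y.hom
  -- the fibre square `W = X ×_Y X` as a `ℂ`-scheme: locally of finite type, hence Jacobson
  let W : SchemeOver ℂ := Over.mk (pullback.fst f.left f.left ≫ X.hom)
  haveI : LocallyOfFiniteType W.hom := by
    change LocallyOfFiniteType (pullback.fst f.left f.left ≫ X.hom)
    infer_instance
  haveI : JacobsonSpace ↥W.left := LocallyOfFiniteType.jacobsonSpace W.hom
  -- every closed point of `W` lies in the image of the diagonal
  have hcl : closedPoints ↥W.left ⊆ Set.range (pullback.diagonal f.left).base := by
    intro w hw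
    let Q : ComplexPoints W := (ComplexPoints.equivClosedPoints W).symm ⟨w, hw⟩
    have hQ : Q.pt = w :=
      congrArg Subtype.val ((ComplexPoints.equivClosedPoints W).apply_symm_apply ⟨w, hw⟩)
    -- the two complex points of `X` under `Q` have the same image in `Y`, hence coincide
    have hW : pullback.snd f.left f.left ≫ X.hom = pullback.fst f.left f.left ≫ X.hom := by
      rw [← Over.w f, ← Category.assoc, ← pullback.condition, Category.assoc]
    let P₁ : ComplexPoints X := Over.homMk (Q.left ≫ pullback.fst f.left f.left) (by
      rw [Category.assoc]; exact Over.w Q)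
    let P₂ : ComplexPoints X := Over.homMk (Q.left ≫ pullback.snd f.left f.left)
      (((Category.assoc _ _ _).trans (congrArg (fun t => Q.left ≫ t) hW)).trans (Over.w Q))
    have h12 : AlgPoints.map f P₁ = AlgPoints.map f P₂ := by
      ext : 1
      change (Q.left ≫ pullback.fst f.left f.left) ≫ f.left = (Q.left ≫ pullback.snd f.left f.left) ≫ f.left
      calc (Q.left ≫ pullback.fst f.left f.left) ≫ f.left
          = Q.left ≫ pullback.fst f.left f.left ≫ f.left := Category.assoc _ _ _
        _ = Q.left ≫ pullback.snd f.left f.left ≫ f.left := congrArg (fun t => Q.left ≫ t) pullback.condition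
        _ = (Q.left ≫ pullback.snd f.left f.left) ≫ f.left := (Category.assoc _ _ _).symm
    have hl : Q.left ≫ pullback.fst f.left f.left = Q.left ≫ pullback.snd f.left f.left :=
      congrArg CommaMorphism.left (hinj h12)
    -- so `Q` factors through the diagonal
    have hfac : (Q.left ≫ pullback.fst f.left f.left) ≫ pullback.diagonal f.left = Q.left := by
      apply pullback.hom_ext
      · rw [Category.assoc, pullback.diagonal_fst]
        exact Category.comp_id _
      · rw [Category.assoc, pullback.diagonal_snd]
        exact (Category.comp_id _).trans hl
    refine ⟨(Q.left ≫ pullback.fst f.left f.left).base (IsLocalRing.closedPoint ℂ), ?_⟩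
    rw [← hQ]
    change _ = Q.left.base (IsLocalRing.closedPoint ℂ)
    rw [← Scheme.Hom.comp_apply, hfac]
    rfl
  -- the diagonal (an open immersion, `f` being unramified) is therefore surjective …
  have hsurj : Function.Surjective (pullback.diagonal f.left).base := by
    rw [← Set.range_eq_univ]
    by_contra hne
    have hZ : (Set.range (pullback.diagonal f.left).base)ᶜ.Nonempty := Set.nonempty_compl.mpr hne
    have hZ' : IsLocallyClosed (Set.range (pullback.diagonal f.left).base)ᶜ :=
      ((pullback.diagonal f.left).isOpenEmbedding.isOpen_range.isClosed_compl).isLocallyClosed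
    haveI : JacobsonSpace ↥(pullback.diagonalObj f.left) := ‹JacobsonSpace ↥W.left›
    obtain ⟨w, hwZ, hwcl⟩ := nonempty_inter_closedPoints hZ hZ'
    exact hwZ (hcl hwcl)
  -- … hence an isomorphism, and `f` is a monomorphism
  haveI : Epi (pullback.diagonal f.left).base := (TopCat.epi_iff_surjective _).mpr hsurj
  haveI : IsIso (pullback.diagonal f.left) := IsOpenImmersion.isIso _
  exact (pullback.isIso_diagonal_iff f.left).mp inferInstance

/-- **A proper unramified `ℂ`-morphism injective on complex points is a closed immersion** (a proper monomorphism is a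
closed immersion: EGA IV₄ 18.12.6 / Stacks 04XV, Mathlib `IsClosedImmersion.iff_isProper_and_mono`; with
`mono_left_of_formallyUnramified_of_injective_complexPoints`).  The shape in which [Deligne 1971] Prop. 1.15 concludes that
the Shimura-variety map `u(K₁, K₂)` is a closed immersion.
[cite: Grothendieck1967, Cor. 18.12.6] [cite: StacksProject, Tag 04XV] [cite: Deligne1971TravauxShimura, Prop. 1.15 (p. 132)] -/
theorem isClosedImmersion_left_of_isProper_of_formallyUnramified_of_injective_complexPoints
    [LocallyOfFiniteType X.hom] [LocallyOfFiniteType Y.hom] [FormallyUnramified f.left] [IsProper f.left]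
    (hinj : Function.Injective (AlgPoints.map f : ComplexPoints X → ComplexPoints Y)) :
    IsClosedImmersion f.left :=
  (IsClosedImmersion.iff_isProper_and_mono f.left).mpr
    ⟨inferInstance, mono_left_of_formallyUnramified_of_injective_complexPoints f hinj⟩

end Literature.AlgebraicGeometry.Morphisms

end
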